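import Summits.HubbardSuperconductivity.HubbardSuperconductivity.Theorems.AnisotropyChordTransferLinearLemmaX

/-!
# Route `AnisotropyChord` / H0 rotor rung, route (1): THE LINEAR TRANSFER CHAIN DISCHARGED (only the symmetric-sector gap
# hypotheses remain) (theory seat `hubbard-h0-rotor-theory-1`, cycle 14, Part N14 v2 Part G; verbatim port, file 3 of 3 of
# PORT SPEC W)

With LEMMA X (`towerExcess_linear`, file `AnisotropyChordTransferLinearLemmaX`) the typed consequences of
`AnisotropyChordTransferLinear` hold: `linearWindowTransfer_holds : LinearWindowTransfer` (THEOREM T-LIN-W: anchor `c₀` +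
symmetric gap `c₁/L` on the growing window `|j| ≤ θ₀L` ⇒ condensate density `≥ c₀/2` on every sector `0 ≤ j ≤ θL`),
`linearWindowTransferRepulsive_holds` (anchor-free on `−0.15 ≤ Δ ≤ 0`), `condensateOnFirstSectors_of_gapInvV_linear` and
`gapInvVLinear_holds : GapInvVLinear` (gap `≥ C/|V|` with the LINEAR threshold `4(1−Δ)k < c₀C` ⇒ BEC on the first `k`
sectors), `condensateOnFirstSectors_repulsive_of_gapInvV_linear`.  (Port of `cycle14/lean/PartN14.lean` v2, sha16
c04a6387500447e8, by the prover seat `hubbard-h0-rotor-p1` g18; no new mathematics.)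
-/


set_option linter.dupNamespace false
set_option autoImplicit false

noncomputable section

open Finset Filter Topology
open Literature.MathematicalPhysics.QuantumLattice Literature.Probability.LatticeModels
open Summit.HubbardSuperconductivity.HubbardSuperconductivity.Theorems.AnisotropyChord
open Summit.HubbardSuperconductivity.HubbardSuperconductivity.Theorems.AnisotropyChord.InsertionEntropy
open Summit.HubbardSuperconductivity.HubbardSuperconductivity.Theorems.AnisotropyChord.Transfer
open Summit.HubbardSuperconductivity.HubbardSuperconductivity.Theorems.AnisotropyChord.Tower

namespace Summit.HubbardSuperconductivity.HubbardSuperconductivity.Theorems.AnisotropyChord.Transfer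

/-! ## Part G — THE CONSEQUENCES, PROVED (port spec W3/W4): only the symmetric-sector gap hypotheses remain -/

/-- **THEOREM T-LIN-W holds**: anchor + (H2-window) ⇒ condensation on the growing window, for every `−1 < Δ < 1`. [folklore] -/
theorem linearWindowTransfer_holds : LinearWindowTransfer :=
  fun _ _ _ _ hΔm hΔ1 hc₀ hc₁ hθ₀ hA hGap =>
    condensateOnLinearWindow_of_gapLinearWindow hΔ1 hc₀ hc₁ hθ₀ (by norm_num) (towerExcess_linear hΔm.le hΔ1.le) hA hGap

/-- **Anchor-free form on the repulsive window** `−0.15 ≤ Δ ≤ 0` (anchor = `halfFillingAnchor_of_repulsive`). [folklore] -/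
theorem linearWindowTransferRepulsive_holds : LinearWindowTransferRepulsive := by
  intro Δ c₁ θ₀ hΔ hΔ' hc₁ hθ₀ hGap
  obtain ⟨c₀, hc₀, hA⟩ := halfFillingAnchor_of_repulsive Δ hΔ hΔ'
  have hΔm : -1 ≤ Δ := by norm_num at hΔ; linarith
  refine ⟨min θ₀ (c₀ * c₁ / (16 * (1 - Δ))), lt_min hθ₀ (div_pos (mul_pos hc₀ hc₁) (by linarith)), c₀ / 2,
    by linarith, ?_⟩
  exact condensateOnLinearWindow_of_gapLinearWindow (by linarith) hc₀ hc₁ hθ₀ (by norm_num)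
    (towerExcess_linear hΔm (by linarith)) hA hGap

set_option maxHeartbeats 1600000 in
/-- **T-LIN at the `1/|V|` scale (port spec W3), PROVED modulo the excess bound as a hypothesis**: `4(1−Δ)k < c₀C`, anchor `c₀`,
`SymmetricSectorGapInvV Δ C (k+1)` ⇒ `CondensateOnFirstSectors Δ k`.  Same ladder as Part E with the link factor `L²/C`
(`c₁ := C/L` in `totalSpinSq_succ_ge_of_gap`), the constant floor `Φ = k² + k + 1` and the budget
`(4(1−Δ)k/C)·L⁴ + (Bk²/C)·L² + k² + k + 1 ≤ ((c₀+ε₀)/2)·L⁴`, `ε₀ = 4(1−Δ)k/C < c₀`. [folklore] -/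
theorem condensateOnFirstSectors_of_gapInvV_linear {Δ c₀ C B : ℝ} {k : ℕ} (hΔ1 : Δ < 1) (hC : 0 < C)
    (hB : 0 ≤ B) (hX : TowerExcessLinear Δ B) (hsmall : 4 * (1 - Δ) * k < c₀ * C)
    (hA : HalfFillingAnchor Δ c₀) (hGap : SymmetricSectorGapInvV Δ C (k + 1)) :
    CondensateOnFirstSectors Δ k := by
  have hInv : PerronTranslationInvariant Δ := perronTranslationInvariant_holds Δ
  obtain ⟨η, hηdef⟩ : ∃ η : ℝ, η = 1 - Δ := ⟨_, rfl⟩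
  have hη : 0 < η := by rw [hηdef]; linarith
  intro j hj
  obtain ⟨ε₀, hε₀def⟩ : ∃ ε₀ : ℝ, ε₀ = 4 * η * k / C := ⟨_, rfl⟩
  have hε₀c : ε₀ < c₀ := by rw [hε₀def, div_lt_iff₀ hC, hηdef]; linarith
  have hε₀0 : 0 ≤ ε₀ := by rw [hε₀def]; positivity
  refine ⟨(c₀ - ε₀) / 2, by linarith, ?_⟩
  obtain ⟨K, hKdef⟩ : ∃ K : ℝ, K = B * (k : ℝ) ^ 2 / C + (k : ℝ) ^ 2 + k + 1 := ⟨_, rfl⟩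
  -- largeness of `L`
  have hT1 : ∀ᶠ L : ℕ in atTop, K ≤ (c₀ - ε₀) / 2 * (L : ℝ) :=
    (Tendsto.const_mul_atTop (by linarith) tendsto_natCast_atTop_atTop).eventually_ge_atTop K
  have hT2 : ∀ᶠ L : ℕ in atTop, 4 * k ≤ L ^ 2 :=
    (eventually_ge_atTop (4 * k)).mono fun L h => le_trans h (Nat.le_self_pow two_ne_zero L)
  have hT3 : ∀ᶠ L : ℕ in atTop, (1 : ℝ) ≤ (L : ℝ) := tendsto_natCast_atTop_atTop.eventually_ge_atTop _
  filter_upwards [hA, hGap, hT1, hT2, hT3] with L hAL hGapL hT1L hT2L hT3L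
  intro _ a ha
  change IsPerronSectorGroundAmplitude L Δ (j : ℝ) a at ha
  have hev : Even L := even_of_perron_nat ha
  obtain ⟨a₀, ha₀⟩ := exists_perron_zero_of_even Δ hev
  have hLpos : (0 : ℝ) < L := by linarith
  have hW : (Fintype.card (TorusSite 2 L) : ℝ) = (L : ℝ) ^ 2 := by
    rw [Fintype.card_fun, ZMod.card, Fintype.card_fin]; push_cast; ring
  have hj0 : (0 : ℝ) ≤ j := Nat.cast_nonneg _
  have hjk : (j : ℝ) ≤ k := by exact_mod_cast hj
  -- Perron amplitudes of the sectors `0 … j`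
  have hexN : ∀ i : ℕ, i ≤ j → ∃ b : TensorIndex (TorusSite 2 L) 2 → ℝ,
      IsPerronSectorGroundAmplitude L Δ (i : ℝ) b := fun i hi => exists_perron_nat ha₀ i (by omega)
  choose! ψ hψ using hexN
  have hψ0 : IsPerronSectorGroundAmplitude L Δ 0 (ψ 0) := by
    have := hψ 0 (Nat.zero_le _); rwa [Nat.cast_zero] at this
  have ea : a = ψ j := perron_eq ha (hψ j le_rfl)
  rw [ea]
  obtain ⟨f, hf⟩ : ∃ f : ℕ → ℝ, ∀ i, f i =
      Summit.HubbardSuperconductivity.HubbardSuperconductivity.Theorems.AnisotropyChord.Tower.totalSpinSq (ψ i) (i : ℝ) :=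
    ⟨_, fun _ => rfl⟩
  -- anchor: `c₀ L⁴ ≤ f 0`
  have hf0 : c₀ * ((L : ℝ) ^ 2) ^ 2 ≤ f 0 := by
    have h := hAL (ψ 0) hψ0
    have e0 : condensateDensity (ψ 0) = lowerNormSq (ψ 0) / (Fintype.card (TorusSite 2 L) : ℝ) ^ 2 := rfl
    rw [e0, hW, le_div_iff₀ (by positivity)] at h
    have : f 0 = lowerNormSq (ψ 0) := by
      rw [hf]
      unfold Summit.HubbardSuperconductivity.HubbardSuperconductivity.Theorems.AnisotropyChord.Tower.totalSpinSq
      push_cast; ring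
    rw [this]; exact h
  -- the floor and the per-link constants (link factor `L²/C`)
  obtain ⟨Φ, hΦdef⟩ : ∃ Φ : ℝ, Φ = (k : ℝ) ^ 2 + k + 1 := ⟨_, rfl⟩
  obtain ⟨Aℓ, hAℓ⟩ : ∃ A : ℝ, A = (L : ℝ) ^ 2 / C * (4 * η * (L : ℝ) ^ 2) := ⟨_, rfl⟩
  obtain ⟨Bℓ, hBℓ⟩ : ∃ B' : ℝ, B' = (L : ℝ) ^ 2 / C * B := ⟨_, rfl⟩
  have hLc : 0 ≤ (L : ℝ) ^ 2 / C := by positivity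
  have hAℓ0 : 0 ≤ Aℓ := by rw [hAℓ]; positivity
  have hBℓ0 : 0 ≤ Bℓ := by rw [hBℓ]; exact mul_nonneg hLc hB
  have hc₁ : 0 < C / (L : ℝ) := div_pos hC hLpos
  -- THE LINK
  have hlink : ∀ M, M < j → Φ ≤ f M → f M - (Aℓ + Bℓ * M) ≤ f (M + 1) := by
    intro M hMj hΦM
    have hψM := hψ M hMj.le
    have hψM1 : IsPerronSectorGroundAmplitude L Δ ((M : ℝ) + 1) (ψ (M + 1)) := by
      have := hψ (M + 1) (by omega); push_cast at this; exact this
    have hMk : (M : ℝ) ≤ k := by exact_mod_cast (by omega : M ≤ k)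
    have hM0 : (0 : ℝ) ≤ M := Nat.cast_nonneg _
    have hMsq : (M : ℝ) ^ 2 ≤ (k : ℝ) ^ 2 := pow_le_pow_left₀ hM0 hMk 2
    have h4M : 4 * M ≤ L ^ 2 := by omega
    have hN : 0 < raiseNormSq (ψ M) := by
      rw [raiseNormSq_eq_totalSpinSq hψM, ← hf]
      rw [hΦdef] at hΦM
      nlinarith
    have hgap : ∀ φ : TensorIndex (TorusSite 2 L) 2 → ℝ,
        cplx L φ ∈ spinZSector (Λ := TorusSite 2 L) 1 ((M : ℝ) + 1) → (∀ v σ, φ (shiftCfg L v σ) = φ σ) →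
        ∑ σ, φ σ ^ 2 = 1 →
          C / (L : ℝ) / (L : ℝ) * (1 - (∑ σ, ψ (M + 1) σ * φ σ) ^ 2) ≤ energyQ L Δ φ - sectorE L Δ ((M : ℝ) + 1) := by
      intro φ hφ hφinv hφunit
      have ecast : (((M + 1 : ℕ) : ℤ) : ℝ) = (M : ℝ) + 1 := by push_cast; ring
      have habs : |(((M + 1 : ℕ) : ℤ))| ≤ ((k + 1 : ℕ) : ℤ) := by
        rw [abs_of_nonneg (by positivity)]; exact_mod_cast (by omega : M + 1 ≤ k + 1)
      have h := hGapL ((M + 1 : ℕ) : ℤ) habs (ψ (M + 1)) φ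
        (by rw [ecast]; exact hψM1) (by rw [ecast]; exact hφ) hφinv hφunit
      rw [ecast, hW] at h
      have e : C / (L : ℝ) / (L : ℝ) = C / (L : ℝ) ^ 2 := by rw [div_div, sq]
      rw [e]; exact h
    have hone := totalSpinSq_succ_ge_of_gap hc₁ hψM hψM1 hgap (hInv L (M : ℝ) (ψ M) hψM) hN
    have hXM := hX L M h4M (ψ M) hψM
    rw [← hηdef] at hXM
    have eLc : (L : ℝ) / (C / (L : ℝ)) = (L : ℝ) ^ 2 / C := by rw [div_div_eq_mul_div, sq]
    rw [eLc] at hone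
    have h4 := mul_le_mul_of_nonneg_left hXM hLc
    have e : Aℓ + Bℓ * M = (L : ℝ) ^ 2 / C * (4 * η * (L : ℝ) ^ 2 + B * (M : ℝ)) := by rw [hAℓ, hBℓ]; ring
    rw [hf, hf, e]
    push_cast
    linarith
  -- budget
  have hL4 : ((L : ℝ) ^ 2) ^ 2 = (L : ℝ) ^ 4 := by ring
  rw [hL4] at hf0
  have hKL : K * (L : ℝ) ^ 3 ≤ (c₀ - ε₀) / 2 * (L : ℝ) ^ 4 := by
    have := mul_le_mul_of_nonneg_right hT1L (by positivity : (0 : ℝ) ≤ (L : ℝ) ^ 3)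
    nlinarith
  have hsmallterms : Bℓ * (k : ℝ) ^ 2 + (k : ℝ) ^ 2 + k + 1 ≤ K * (L : ℝ) ^ 3 := by
    have hL13 : (1 : ℝ) ≤ (L : ℝ) ^ 3 := by nlinarith
    have hL23 : (L : ℝ) ^ 2 ≤ (L : ℝ) ^ 3 := by nlinarith
    have e1 : Bℓ * (k : ℝ) ^ 2 = B * (k : ℝ) ^ 2 / C * (L : ℝ) ^ 2 := by rw [hBℓ]; ring
    have hBk : 0 ≤ B * (k : ℝ) ^ 2 / C := by positivity
    have h1 := mul_le_mul_of_nonneg_left hL23 hBk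
    have hk2 : 0 ≤ (k : ℝ) ^ 2 := sq_nonneg _
    have hk0 : 0 ≤ (k : ℝ) := Nat.cast_nonneg _
    have h2 := mul_le_mul_of_nonneg_left hL13 hk2
    have h3 := mul_le_mul_of_nonneg_left hL13 hk0
    have eK : K * (L : ℝ) ^ 3 = B * (k : ℝ) ^ 2 / C * (L : ℝ) ^ 3 + (k : ℝ) ^ 2 * (L : ℝ) ^ 3 + (k : ℝ) * (L : ℝ) ^ 3
        + (L : ℝ) ^ 3 := by rw [hKdef]; ring
    rw [e1, eK]; linarith
  have hAj : Aℓ * j ≤ ε₀ * (L : ℝ) ^ 4 := by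
    calc Aℓ * j ≤ Aℓ * k := mul_le_mul_of_nonneg_left hjk hAℓ0
      _ = ε₀ * (L : ℝ) ^ 4 := by rw [hAℓ, hε₀def]; ring
  have hjsq : (j : ℝ) ^ 2 ≤ (k : ℝ) ^ 2 := pow_le_pow_left₀ hj0 hjk 2
  have hBj : Bℓ * (j : ℝ) ^ 2 ≤ Bℓ * (k : ℝ) ^ 2 := mul_le_mul_of_nonneg_left hjsq hBℓ0
  have hbudget : Φ ≤ f 0 - (Aℓ * j + Bℓ * (j : ℝ) ^ 2) := by
    rw [hΦdef]
    have hL40 : 0 ≤ (c₀ - ε₀) / 2 * (L : ℝ) ^ 4 := by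
      have : 0 ≤ (L : ℝ) ^ 4 := by positivity
      nlinarith
    linarith [hf0, hAj, hBj, hsmallterms, hKL]
  -- run the ladder and read off the condensate density of `ψ_j`
  have hchain := floorLadder f Aℓ Bℓ Φ j hAℓ0 hBℓ0 hlink hbudget j le_rfl
  have e1 : condensateDensity (ψ j) = lowerNormSq (ψ j) / (Fintype.card (TorusSite 2 L) : ℝ) ^ 2 := rfl
  rw [e1, hW, hL4, le_div_iff₀ (by positivity), lowerNormSq_eq_totalSpinSq (j : ℝ) (ψ j), ← hf]
  linarith [hchain, hf0, hAj, hBj, hsmallterms, hKL, hjsq, hj0]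

/-- **`GapInvVLinear` — PROVED.** (The tree's `condensateOnFirstSectors_of_gapInvV_open` needs `C ≥ 2(k+1)D_k/c₀ + 1` and `0 ≤ Δ`;
here `C > 4(1−Δ)k/c₀` and `−1 < Δ < 1`.) [folklore] -/
theorem gapInvVLinear_holds : GapInvVLinear := fun _ _ _ _ hΔm hΔ1 _ hC hsmall hA hGap =>
  condensateOnFirstSectors_of_gapInvV_linear hΔ1 hC (by norm_num) (towerExcess_linear hΔm.le hΔ1.le) hsmall hA hGap

/-- **Anchor-free repulsive-window corollary with the LINEAR threshold** (cf. the tree's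
`condensateOnFirstSectors_repulsive_of_gapInvV`, threshold `2(k+1)D_k/c₀ + 1`): for `−0.15 ≤ Δ ≤ 0` there is `c₀ > 0` (the
KLS/Kubo–Kishi anchor) such that every `C` with `4(1−Δ)k < c₀C` and `SymmetricSectorGapInvV Δ C (k+1)` give condensation on the
first `k` sectors. [folklore] -/
theorem condensateOnFirstSectors_repulsive_of_gapInvV_linear {Δ : ℝ} (hΔ : -0.15 ≤ Δ) (hΔ' : Δ ≤ 0) (k : ℕ) :
    ∃ c₀ > (0 : ℝ), HalfFillingAnchor Δ c₀ ∧
      ∀ C : ℝ, 4 * (1 - Δ) * k < c₀ * C → SymmetricSectorGapInvV Δ C (k + 1) → CondensateOnFirstSectors Δ k := by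
  obtain ⟨c₀, hc₀, hA⟩ := halfFillingAnchor_of_repulsive Δ hΔ hΔ'
  have hΔm : -1 < Δ := by norm_num at hΔ; linarith
  refine ⟨c₀, hc₀, hA, fun C hsmall hGap => ?_⟩
  have hk0 : 0 ≤ 4 * (1 - Δ) * (k : ℝ) := mul_nonneg (by linarith) (Nat.cast_nonneg k)
  have hC : 0 < C := by
    by_contra h
    push Not at h
    nlinarith [mul_nonneg hc₀.le (neg_nonneg.mpr h)]
  exact gapInvVLinear_holds Δ c₀ C k hΔm (by linarith) hc₀ hC hsmall hA hGap

end Summit.HubbardSuperconductivity.HubbardSuperconductivity.Theorems.AnisotropyChord.Transfer
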